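import Literature.Probability.RandomPlanarGeometry.SLESameSidePathwise
import HarnessLib

/-!
# The same-side two-point problem: the sharp upper bound

Trunk T-STOCH. For `4 < κ < 8` and `0 < y < x`, with `h = sameSideH (2/κ)`, `z₀ = x/(x-y)` and any
upper level `1 + R > z₀`:

  `(h(1+R) - A) · P[T_y = T_x] ≤ h(z₀) - A` for every lower bound `A` of `h` on `(1, ∞)`

(`measureReal_swallowingTime_eq_le`). Together with the tree's lower bound
`h(z₀) - h(1+δ₀) ≤ (M - h(1+δ₀)) · P[T_y = T_x]` (`measureReal_swallowingTime_eq_ge`,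
`SLESwallowedRealPoints`) and the end values `h(1+) = h(1)`, `h(∞) = sameSideHTop` of
`SLESameSideKernelLimits`, this gives the sharp same-side two-point law
`P[T_y = T_x] = (h(z₀) - h(1))/(h(∞) - h(1))` of S. Rohde, O. Schramm, *Basic properties of
SLE*, Ann. of Math. 161 (2005), Lemma 6.6 (the hitting-probability content of eq. (6.13); the
assembly is in the sequel).

Proof ("the local martingale … optional sampling", p. 908, made honest about the terminal value):
`{T_y = T_x} ⊆ {T_y = ∞} ∪ Bad ∪ High`, where `High = {Z reaches 1 + R before T_y}`,
`Z = X/(X-Y)`, and `Bad = {T_y = T_x < ∞, Z < 1 + R on [0, T_y)}`.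
* `P[T_y = ∞] = 0` for `κ > 4` (`sle_swallowingTime_lt_top_of_onePointMartingales`).
* `P[Bad] = 0` (`measure_sameSide_bad_eq_zero`): by the uniform energy bound
  `E ∫₀^{n∧ρ_n} κ K(Z)²/(X-Y)² ≤ C` (`integral_sameSide_energy_le`, the Itô formula for `h²`) and
  Fatou, `liminf_n ∫₀^{n∧ρ_n} < ∞` a.s., while on `Bad` these stopped energies tend to `+∞`
  (`eventually_le_sameSide_energy`: the energy rate dominates `c/(XY)` when `κ < 8`, and
  `∫ 2/(XY) = log(x-y) - log(X-Y) → ∞` as the gap closes at `T_x = T_y`).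
* `P[High] ≤ (h(z₀) - A)/(h(1+R) - A)` (`measureReal_sameSide_high_le`): `High ⊆ liminf_n Hit_n`,
  `Hit_n = {Z_{n∧ρ_n} = 1 + R}` (`eventually_sameSide_stopped_ratio_eq`), and
  `(h(1+R) - A) P[Hit_n] ≤ h(z₀) - A` for every `n` (`measureReal_sameSide_hit_le`, constancy of
  `E h(Z_{t∧ρ})`).

## References

* S. Rohde, O. Schramm, *Basic properties of SLE*, Ann. of Math. 161 (2005), Lemma 6.6 and its
  proof (p. 908).
* G. F. Lawler, *Conformally Invariant Processes in the Plane*, AMS (2005), §6.7, Prop. 6.34.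
-/

noncomputable section

open MeasureTheory ProbabilityTheory Filter Set Topology
open scoped NNReal ENNReal

namespace Literature.Probability.RandomPlanarGeometry

open Loewner Literature.Probability.Process Literature.Analysis.FunctionSpaces
  Literature.Analysis.Calculus

variable {κ : ℝ≥0} {x y : ℝ}

/-! ### `P[Bad] = 0` -/

/-- **The bad event is null.** For `4 < κ < 8`, `0 < y < x`, `z₀ < 1 + R`: almost no path has
`T_y = T_x = T < ∞` with `Z = X/(X-Y) < 1 + R` throughout `[0, T)`. (Fatou on the stopped energies
along the diagonal levels, `integral_sameSide_energy_le`, against their divergence on the event,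
`eventually_le_sameSide_energy`.) [cite: RohdeSchramm2005, proof of Lemma 6.6] -/
theorem measure_sameSide_bad_eq_zero (hκ4 : 4 < κ) (hκ8 : κ < 8) (hy : 0 < y) (hyx : y < x)
    {R : ℝ} (hz₀' : x / (x - y) < 1 + R) {A M : ℝ}
    (hA : ∀ z : ℝ, 1 < z → A ≤ sameSideH (2 / (κ : ℝ)) z)
    (hM : ∀ z : ℝ, 1 < z → sameSideH (2 / (κ : ℝ)) z ≤ M) :
    preWienerMeasure {ω | ∃ T : ℝ≥0, swallowingTime (sleDriving κ ω) y = T ∧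
      swallowingTime (sleDriving κ ω) x = T ∧ ∀ t : ℝ≥0, t < T →
        sleRealFlowStop κ x t ω / (sleRealFlowStop κ x t ω - sleRealFlowStop κ y t ω) < 1 + R} = 0 := by
  haveI := isProbabilityMeasure_preWienerMeasure'
  set μ : Measure (ℝ≥0 → ℝ) := preWienerMeasure with hμ
  -- the stopped energies along the diagonal
  set I : ℝ≥0 → (ℝ≥0 → ℝ) → ℝ := fun s ω ↦ (κ : ℝ) * sameSideKernel (2 / (κ : ℝ))
      (sleRealFlowStop κ x s ω / (sleRealFlowStop κ x s ω - sleRealFlowStop κ y s ω)) ^ 2 /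
    (sleRealFlowStop κ x s ω - sleRealFlowStop κ y s ω) ^ 2 with hI
  set Φ : ℕ → (ℝ≥0 → ℝ) → ℝ := fun n ω ↦ timeIntegral (trunc
    (sleSameSideTime κ x y (y / (n + 2) / (2 * (x - y))) R (y / (n + 2)) (y + n + 1)) I) n ω with hΦ
  set C : ℝ := (max |A| |M|) ^ 2 with hC
  have hΦfacts : ∀ n : ℕ, Measurable (Φ n) ∧ Integrable (Φ n) μ ∧ (∀ ω, 0 ≤ Φ n ω) ∧
      ∫ ω, Φ n ω ∂μ ≤ C := by
    intro n
    obtain ⟨hδ₀, hz₀, hδ₁, hδ₁y, hyR₁⟩ := sameSide_diagonal_levels hy hyx n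
    exact integral_sameSide_energy_le hy hyx hδ₀ hz₀ hz₀' hδ₁ hδ₁y hyR₁ hκ4 hA hM n
  -- Fatou: `liminf Φ_n < ∞` a.s.
  set L : (ℝ≥0 → ℝ) → ℝ≥0∞ := fun ω ↦ liminf (fun n ↦ ENNReal.ofReal (Φ n ω)) atTop with hL
  have hmeas : ∀ n, Measurable fun ω ↦ ENNReal.ofReal (Φ n ω) := fun n ↦
    (hΦfacts n).1.ennreal_ofReal
  have hLm : Measurable L := Measurable.liminf hmeas
  have hLint : ∫⁻ ω, L ω ∂μ ≤ ENNReal.ofReal C := by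
    refine (lintegral_liminf_le hmeas).trans ?_
    refine liminf_le_of_frequently_le (Frequently.of_forall fun n ↦ ?_)
    obtain ⟨-, hint, hnn, hle⟩ := hΦfacts n
    rw [← ofReal_integral_eq_lintegral_ofReal hint (ae_of_all _ hnn)]
    exact ENNReal.ofReal_le_ofReal hle
  have hLtop : μ {ω | L ω = ⊤} = 0 := by
    have hae := ae_lt_top hLm (ne_top_of_le_ne_top ENNReal.ofReal_ne_top hLint)
    rw [ae_iff] at hae
    refine measure_mono_null (fun ω hω ↦ ?_) hae
    simp only [mem_setOf_eq] at hω ⊢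
    rw [hω]; exact lt_irrefl _
  -- the bad event lies in `{L = ⊤}`
  refine measure_mono_null (fun ω hω ↦ ?_) hLtop
  obtain ⟨T, hTy, hTx, hZ⟩ := hω
  change L ω = ⊤
  refine ENNReal.eq_top_of_forall_nnreal_le fun r ↦ ?_
  obtain ⟨N, hN⟩ := eventually_le_sameSide_energy hy hyx hz₀' hκ4 hκ8 hTy hTx hZ (r : ℝ)
  refine le_liminf_of_le (by isBoundedDefault) ?_
  filter_upwards [eventually_ge_atTop N] with n hn
  rw [← ENNReal.ofReal_coe_nnreal]
  exact ENNReal.ofReal_le_ofReal (hN n hn)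

/-! ### `P[High] ≤ (h(z₀) - A)/(h(1+R) - A)` -/

/-- **The probability that the ratio reaches `1 + R` before `T_y`.** For `4 < κ`, `0 < y < x`,
`z₀ = x/(x-y) < 1 + R`, `h = sameSideH (2/κ)` and any lower bound `A` of `h` on `(1, ∞)`:
`(h(1+R) - A) · P[∃ t < T_y, Z_t ≥ 1 + R] ≤ h(z₀) - A` (`High ⊆ liminf Hit_n` by
`eventually_sameSide_stopped_ratio_eq`, and `measureReal_sameSide_hit_le` for each `n`).
[cite: RohdeSchramm2005, proof of Lemma 6.6] -/
theorem measureReal_sameSide_high_le (hκ4 : 4 < κ) (hy : 0 < y) (hyx : y < x)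
    {R : ℝ} (hz₀' : x / (x - y) < 1 + R) {A : ℝ}
    (hA : ∀ z : ℝ, 1 < z → A ≤ sameSideH (2 / (κ : ℝ)) z) :
    (sameSideH (2 / (κ : ℝ)) (1 + R) - A) *
        preWienerMeasure.real {ω | ∃ t : ℝ≥0, (t : WithTop ℝ≥0) < swallowingTime (sleDriving κ ω) y ∧
          1 + R ≤ sleRealFlowStop κ x t ω / (sleRealFlowStop κ x t ω - sleRealFlowStop κ y t ω)} ≤
      sameSideH (2 / (κ : ℝ)) (x / (x - y)) - A := by
  haveI := isProbabilityMeasure_preWienerMeasure'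
  set μ : Measure (ℝ≥0 → ℝ) := preWienerMeasure with hμ
  set a : ℝ := 2 / (κ : ℝ) with ha
  set h := sameSideH a with hh
  have hxy : 0 < x - y := by linarith
  have hz₀1 : 1 < x / (x - y) := by rw [one_lt_div hxy]; linarith
  have hR : 0 < R := by linarith
  -- `D = h(1+R) - A > 0`
  have hmono : StrictMonoOn h (Ioi 1) := strictMonoOn_sameSideH a
  set D : ℝ := h (1 + R) - A with hD
  have hDpos : 0 < D := by
    have hR2 : (1 : ℝ) < 1 + R / 2 := by linarith
    have hR1 : (1 : ℝ) < 1 + R := by linarith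
    have h1 : A ≤ h (1 + R / 2) := hA _ hR2
    have h2 : h (1 + R / 2) < h (1 + R) := hmono hR2 hR1 (by linarith)
    simp only [hD]; linarith
  -- the events `Hit n`
  set Hit : ℕ → Set (ℝ≥0 → ℝ) := fun n ↦ {ω |
    stoppedProcess (sleRealFlowStop κ x)
        (sleSameSideTime κ x y (y / (n + 2) / (2 * (x - y))) R (y / (n + 2)) (y + n + 1)) n ω /
      (stoppedProcess (sleRealFlowStop κ x)
          (sleSameSideTime κ x y (y / (n + 2) / (2 * (x - y))) R (y / (n + 2)) (y + n + 1)) n ω -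
        stoppedProcess (sleRealFlowStop κ y)
          (sleSameSideTime κ x y (y / (n + 2) / (2 * (x - y))) R (y / (n + 2)) (y + n + 1)) n ω) =
      1 + R} with hHit
  have hHitle : ∀ n : ℕ, μ.real (Hit n) ≤ (h (x / (x - y)) - A) / D := by
    intro n
    obtain ⟨hδ₀, hz₀, hδ₁, hδ₁y, hyR₁⟩ := sameSide_diagonal_levels hy hyx n
    have hb := measureReal_sameSide_hit_le hy hyx hδ₀ hz₀ hz₀' hδ₁ hδ₁y hyR₁ hκ4 hA n
    rw [le_div_iff₀ hDpos, mul_comm]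
    exact hb
  -- `High ⊆ ⋃ N, ⋂ n ≥ N, Hit n`
  set E : ℕ → Set (ℝ≥0 → ℝ) := fun N ↦ ⋂ n, ⋂ (_ : N ≤ n), Hit n with hE
  have hEmono : Monotone E := fun N N' hNN' ω hω ↦ by
    simp only [hE, mem_iInter] at hω ⊢
    exact fun n hn ↦ hω n (hNN'.trans hn)
  have hsub : {ω : ℝ≥0 → ℝ | ∃ t : ℝ≥0, (t : WithTop ℝ≥0) < swallowingTime (sleDriving κ ω) y ∧
      1 + R ≤ sleRealFlowStop κ x t ω / (sleRealFlowStop κ x t ω - sleRealFlowStop κ y t ω)} ⊆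
      ⋃ N, E N := by
    intro ω hω
    obtain ⟨t, ht, hZt⟩ := hω
    obtain ⟨N, hN⟩ := eventually_sameSide_stopped_ratio_eq hy hyx hz₀' ht hZt
    simp only [mem_iUnion, hE, mem_iInter]
    exact ⟨N, fun n hn ↦ hN n hn⟩
  have hEle : ∀ N, μ (E N) ≤ ENNReal.ofReal ((h (x / (x - y)) - A) / D) := fun N ↦ by
    have h1 : μ (E N) ≤ μ (Hit N) := measure_mono fun ω hω ↦ by
      simp only [hE, mem_iInter] at hω
      exact hω N le_rfl
    refine h1.trans ?_
    rw [← ENNReal.ofReal_toReal (measure_ne_top μ (Hit N))]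
    exact ENNReal.ofReal_le_ofReal (hHitle N)
  have hUnion : μ (⋃ N, E N) ≤ ENNReal.ofReal ((h (x / (x - y)) - A) / D) := by
    rw [hEmono.measure_iUnion]
    exact iSup_le hEle
  have hreal : μ.real {ω : ℝ≥0 → ℝ | ∃ t : ℝ≥0, (t : WithTop ℝ≥0) < swallowingTime (sleDriving κ ω) y ∧
      1 + R ≤ sleRealFlowStop κ x t ω / (sleRealFlowStop κ x t ω - sleRealFlowStop κ y t ω)} ≤
      (h (x / (x - y)) - A) / D := by
    have hnn : 0 ≤ (h (x / (x - y)) - A) / D :=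
      div_nonneg (sub_nonneg.2 (hA _ hz₀1)) hDpos.le
    have h1 := (measure_mono hsub).trans hUnion
    rw [measureReal_def]
    exact ENNReal.toReal_le_of_le_ofReal hnn h1
  change D * μ.real _ ≤ h (x / (x - y)) - A
  rw [mul_comm, ← le_div_iff₀ hDpos]
  exact hreal

/-! ### The upper bound -/

/-- **Sharp same-side upper bound, `4 < κ < 8`.** For `0 < y < x`, `z₀ = x/(x-y) < 1 + R`,
`h = sameSideH (2/κ)`, bounds `A ≤ h ≤ M` on `(1, ∞)`:
`(h(1+R) - A) · P[T_y = T_x] ≤ h(z₀) - A`. (`{T_y = T_x} ⊆ {T_y = ∞} ∪ Bad ∪ High` and the three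
estimates `sle_swallowingTime_lt_top_of_onePointMartingales`, `measure_sameSide_bad_eq_zero`,
`measureReal_sameSide_high_le`.) Letting `R → ∞` and `A = h(1+)`: `P[T_y = T_x] ≤
(h(z₀) - h(1+))/(h(∞) - h(1+))`, the upper half of Rohde–Schramm's (6.13).
[cite: RohdeSchramm2005, Lemma 6.6] -/
theorem measureReal_swallowingTime_eq_le (hκ4 : 4 < κ) (hκ8 : κ < 8) (hy : 0 < y) (hyx : y < x)
    {R : ℝ} (hz₀' : x / (x - y) < 1 + R) {A M : ℝ}
    (hA : ∀ z : ℝ, 1 < z → A ≤ sameSideH (2 / (κ : ℝ)) z)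
    (hM : ∀ z : ℝ, 1 < z → sameSideH (2 / (κ : ℝ)) z ≤ M) :
    (sameSideH (2 / (κ : ℝ)) (1 + R) - A) *
        preWienerMeasure.real {ω | swallowingTime (sleDriving κ ω) y = swallowingTime (sleDriving κ ω) x} ≤
      sameSideH (2 / (κ : ℝ)) (x / (x - y)) - A := by
  haveI := isProbabilityMeasure_preWienerMeasure'
  set μ : Measure (ℝ≥0 → ℝ) := preWienerMeasure with hμ
  set a : ℝ := 2 / (κ : ℝ) with ha
  set h := sameSideH a with hh
  have hxy : 0 < x - y := by linarith
  have hz₀1 : 1 < x / (x - y) := by rw [one_lt_div hxy]; linarith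
  have hR : 0 < R := by linarith
  have hmono : StrictMonoOn h (Ioi 1) := strictMonoOn_sameSideH a
  have hR1 : (1 : ℝ) < 1 + R := by linarith
  have hDnn : 0 ≤ h (1 + R) - A := sub_nonneg.2 (hA _ hR1)
  -- the three events
  set Ev : Set (ℝ≥0 → ℝ) := {ω | swallowingTime (sleDriving κ ω) y = swallowingTime (sleDriving κ ω) x}
    with hEv
  set N₀ : Set (ℝ≥0 → ℝ) := {ω | swallowingTime (sleDriving κ ω) y = ⊤} with hN₀
  set Bad : Set (ℝ≥0 → ℝ) := {ω | ∃ T : ℝ≥0, swallowingTime (sleDriving κ ω) y = T ∧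
      swallowingTime (sleDriving κ ω) x = T ∧ ∀ t : ℝ≥0, t < T →
        sleRealFlowStop κ x t ω / (sleRealFlowStop κ x t ω - sleRealFlowStop κ y t ω) < 1 + R} with hBad
  set High : Set (ℝ≥0 → ℝ) := {ω | ∃ t : ℝ≥0, (t : WithTop ℝ≥0) < swallowingTime (sleDriving κ ω) y ∧
      1 + R ≤ sleRealFlowStop κ x t ω / (sleRealFlowStop κ x t ω - sleRealFlowStop κ y t ω)} with hHigh
  have hsplit : Ev ⊆ N₀ ∪ Bad ∪ High := by
    intro ω hω
    by_cases hT : swallowingTime (sleDriving κ ω) y = ⊤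
    · exact Or.inl (Or.inl hT)
    by_cases hhigh : ω ∈ High
    · exact Or.inr hhigh
    refine Or.inl (Or.inr ?_)
    obtain ⟨T, hTy⟩ := WithTop.ne_top_iff_exists.1 hT
    refine ⟨T, hTy.symm, ?_, fun t ht ↦ ?_⟩
    · rw [hTy]; exact hω.symm
    · by_contra hge
      refine hhigh ⟨t, ?_, not_lt.1 hge⟩
      rw [← hTy]; exact_mod_cast ht
  have hN0 : μ N₀ = 0 := by
    have hae := sle_swallowingTime_lt_top_of_onePointMartingales sle_martingale_onePointPow_holds
      sle_martingale_onePointSq_holds hκ4 hy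
    rw [ae_iff] at hae
    refine measure_mono_null (fun ω hω ↦ ?_) hae
    simp only [mem_setOf_eq] at hω ⊢
    rw [hω]; exact lt_irrefl _
  have hBad0 : μ Bad = 0 := measure_sameSide_bad_eq_zero hκ4 hκ8 hy hyx hz₀' hA hM
  have hHighle := measureReal_sameSide_high_le hκ4 hy hyx hz₀' hA
  have hEvle : μ.real Ev ≤ μ.real High := by
    calc μ.real Ev ≤ μ.real (N₀ ∪ Bad ∪ High) := measureReal_mono hsplit
      _ ≤ μ.real (N₀ ∪ Bad) + μ.real High := measureReal_union_le _ _
      _ ≤ μ.real N₀ + μ.real Bad + μ.real High := by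
          gcongr; exact measureReal_union_le _ _
      _ = μ.real High := by
          rw [show μ.real N₀ = 0 by simp [measureReal_def, hN0],
            show μ.real Bad = 0 by simp [measureReal_def, hBad0]]
          ring
  calc (h (1 + R) - A) * μ.real Ev ≤ (h (1 + R) - A) * μ.real High :=
        mul_le_mul_of_nonneg_left hEvle hDnn
    _ ≤ h (x / (x - y)) - A := hHighle

end Literature.Probability.RandomPlanarGeometry
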